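import Summits.AtomisticToContinuum.HydrodynamicLimit.Theorems.CollisionIsometryCLTDiffuseBackwardInfluenceOnePathBound
import HarnessLib
import Summits.AtomisticToContinuum.HydrodynamicLimit.Theorems.CollisionIsometryCLTDiffuseBackwardInfluencePairDefs


namespace Summit.AtomisticToContinuum.HydrodynamicLimit.Theorems.DiffuseBackwardInfluenceShare

open scoped BigOperators Topology ENNReal InnerProductSpace Classical
open Filter Set MeasureTheory
open Literature.Analysis.FluidPDE (Config HardSphereFlow collidePair)
open Literature.MathematicalPhysics.KineticTheory (localGibbsLaw hsDiameter)
open Summit.AtomisticToContinuum.HydrodynamicLimit.Theorems.DiffuseBackwardInfluenceNeg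

noncomputable section

/-!
# WORKER FILE SLOT — slot / counter combinatorics of the marked pair process over one source `C : OnePath.Src N`
(started-slot counter `cnt`, gap counter `gap`, score increment `dlt`), and the idle/degenerate CHARGE BUDGET.
Target: Theorems/CollisionIsometryCLTDiffuseBackwardInfluencePairSlots.lean. Prove every `sorry` WITHOUT changing statements
(if one is false/unprovable as stated, stop and report `stub-misstated` with the corrected statement). Unused hypotheses may be
renamed with a leading `_` (never deleted). Useful landed API: `OnePath.slotStart_mono`, `OnePath.slotStart_self`,
`OnePath.slot_unique`, `OnePath.colls_mono`, `OnePath.cfirst_spec`, `OnePath.not_touches_of_lt_cfirst`, `OnePath.idleOn_iff_not_hasCollIn`,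
`OnePath.mu_succ_of_ne`, `OnePath.fr_mem_of_scores` (pattern), `OnePath.sum_one_sub_Gr_le` / `OnePath.sum_Gr_eq` (pattern for §B).
-/

namespace PairPath

section SlotLemmas

variable {N : ℕ} {C : OnePath.Src N}

/-! ### §C Counters -/

/-- The grid is nonempty. [folklore] -/
theorem S_pos (hm : 1 ≤ C.m) (hL : 1 ≤ C.L) : 0 < S C := by
  unfold S
  exact Nat.mul_pos (Nat.mul_pos (by norm_num) hm) hL

/-- At most `S` slots are ever started. [folklore] -/
theorem cnt_le (n : ℕ) : cnt C n ≤ S C := by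
  unfold cnt
  exact (Finset.card_filter_le _ _).trans (Finset.card_range _).le

/-- The gap never exceeds the number of started slots. [folklore] -/
theorem gap_le_cnt (n : ℕ) (i : Fin (N + 1)) : gap C n i ≤ cnt C n := by
  unfold gap cnt
  refine Finset.card_le_card fun r hr => ?_
  rw [Finset.mem_filter] at hr ⊢
  exact ⟨hr.1, hr.2.1⟩

/-- `cnt` is monotone. [folklore] -/
theorem cnt_mono {n n' : ℕ} (h : n ≤ n') : cnt C n ≤ cnt C n' := by
  unfold cnt
  refine Finset.card_le_card fun r hr => ?_
  rw [Finset.mem_filter] at hr ⊢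
  exact ⟨hr.1, hr.2.trans h⟩

/-- The score increment is `0` or `1`. [folklore] -/
theorem dlt_le_one (n : ℕ) (i : Fin (N + 1)) : dlt C n i ≤ 1 := by
  unfold dlt
  split_ifs <;> omega

/-- Initially the gap of every particle is the number of slots started at step `0`. [folklore] -/
theorem gap_zero (i : Fin (N + 1)) : gap C 0 i = cnt C 0 := by
  unfold gap cnt
  exact congrArg _ (Finset.filter_congr fun r _ =>
    ⟨fun h => h.1, fun h => ⟨h, fun c _ hc => absurd hc (Nat.not_lt_zero c)⟩⟩)

/-- Every slot start is at most the last fold step (window with at least one fold step). -/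
private theorem nS_le_fin (hΔ : 0 < C.Δ) (hpos : 0 < OnePath.fin C) (hS : 0 < 2 * C.m * C.L) {r : ℕ}
    (hr : r ≤ 2 * C.m * C.L) : OnePath.nS C r ≤ OnePath.fin C := by
  have := OnePath.slotStart_mono (σ := C.σ) (y := C.y) hΔ hpos hS hr le_rfl
  rwa [OnePath.slotStart_self (σ := C.σ) (y := C.y) (Δ := C.Δ) hS] at this

/-- The started slots form an initial segment: `r < cnt n ↔ r < S ∧ nS r ≤ n` (slot starts are monotone). -/
private theorem lt_cnt_iff (hΔ : 0 < C.Δ) (hpos : 0 < OnePath.fin C) {n r : ℕ} :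
    r < cnt C n ↔ r < S C ∧ OnePath.nS C r ≤ n := by
  constructor
  · intro hr
    by_contra hnot
    have hsub : ((Finset.range (S C)).filter fun r' => OnePath.nS C r' ≤ n) ⊆ Finset.range r := by
      intro r' hr'
      rw [Finset.mem_filter, Finset.mem_range] at hr'
      rw [Finset.mem_range]
      by_contra hle
      have hS : 0 < 2 * C.m * C.L := lt_of_le_of_lt (Nat.zero_le _) hr'.1
      have hm := OnePath.slotStart_mono (σ := C.σ) (y := C.y) hΔ hpos hS (not_lt.1 hle) hr'.1.le
      exact hnot ⟨lt_of_le_of_lt (not_lt.1 hle) hr'.1, hm.trans hr'.2⟩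
    have := Finset.card_le_card hsub
    rw [Finset.card_range] at this
    unfold cnt at hr
    omega
  · rintro ⟨hrS, hrn⟩
    have hS : 0 < 2 * C.m * C.L := lt_of_le_of_lt (Nat.zero_le _) hrS
    have hsub : Finset.range (r + 1) ⊆ (Finset.range (S C)).filter fun r' => OnePath.nS C r' ≤ n := by
      intro r' hr'
      rw [Finset.mem_range] at hr'
      rw [Finset.mem_filter, Finset.mem_range]
      refine ⟨by omega, le_trans ?_ hrn⟩
      exact OnePath.slotStart_mono (σ := C.σ) (y := C.y) hΔ hpos hS (Nat.lt_succ_iff.1 hr') hrS.le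
    have := Finset.card_le_card hsub
    rw [Finset.card_range] at this
    unfold cnt
    omega

/-- By the last fold step every slot has started. [folklore] -/
theorem cnt_fin (hΔ : 0 < C.Δ) (hpos : 0 < OnePath.fin C) (hm : 1 ≤ C.m) (hL : 1 ≤ C.L) :
    cnt C (OnePath.fin C) = S C := by
  have hS : 0 < 2 * C.m * C.L := Nat.mul_pos (Nat.mul_pos (by norm_num) hm) hL
  unfold cnt
  rw [Finset.filter_true_of_mem fun r hr => ?_, Finset.card_range]
  exact nS_le_fin hΔ hpos hS (Finset.mem_range.1 hr).le

/-- Inside slot `r` exactly the slots `0, …, r` have started. [folklore] -/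
theorem cnt_eq_succ_of_mem_slot (hΔ : 0 < C.Δ) (hpos : 0 < OnePath.fin C) {r n : ℕ} (hr : r < S C)
    (h1 : OnePath.nS C r ≤ n) (h2 : n < OnePath.nS C (r + 1)) : cnt C n = r + 1 := by
  have hlt : r < cnt C n := (lt_cnt_iff hΔ hpos).2 ⟨hr, h1⟩
  have hnot : ¬ r + 1 < cnt C n := fun h => by
    have := ((lt_cnt_iff hΔ hpos).1 h).2
    omega
  omega

/-- The number of slots starting exactly at step `n + 1`. -/
private theorem card_new (n : ℕ) :
    ((Finset.range (S C)).filter fun r => OnePath.nS C r = n + 1).card = cnt C (n + 1) - cnt C n := by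
  have h := Finset.card_filter_add_card_filter_not
    (s := (Finset.range (S C)).filter fun r => OnePath.nS C r ≤ n + 1) (fun r => OnePath.nS C r ≤ n)
  rw [Finset.filter_filter, Finset.filter_filter] at h
  have e1 : ((Finset.range (S C)).filter fun r => OnePath.nS C r ≤ n + 1 ∧ OnePath.nS C r ≤ n) =
      (Finset.range (S C)).filter fun r => OnePath.nS C r ≤ n :=
    Finset.filter_congr fun r _ => ⟨fun h => h.2, fun h => ⟨Nat.le_succ_of_le h, h⟩⟩
  have e2 : ((Finset.range (S C)).filter fun r => OnePath.nS C r ≤ n + 1 ∧ ¬ OnePath.nS C r ≤ n) =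
      (Finset.range (S C)).filter fun r => OnePath.nS C r = n + 1 :=
    Finset.filter_congr fun r _ => by omega
  rw [e1, e2] at h
  unfold cnt
  omega

/-- An untouched particle keeps its gap, enlarged by the slots starting meanwhile. [folklore] -/
theorem gap_succ_of_not_touches {n : ℕ} {i : Fin (N + 1)} (hi : ¬ Touches C.σ N C.y n i) :
    gap C (n + 1) i = gap C n i + (cnt C (n + 1) - cnt C n) := by
  rw [← card_new n]
  unfold gap
  rw [Finset.card_filter, Finset.card_filter, Finset.card_filter, ← Finset.sum_add_distrib]
  refine Finset.sum_congr rfl fun r _ => ?_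
  by_cases h1 : OnePath.nS C r ≤ n
  · rw [if_neg (show ¬ OnePath.nS C r = n + 1 by omega), add_zero]
    split_ifs with hP hQ hQ
    · rfl
    · exact absurd ⟨h1, fun c hc1 hc2 => hP.2 c hc1 (Nat.lt_succ_of_lt hc2)⟩ hQ
    · refine absurd ⟨Nat.le_succ_of_le h1, fun c hc1 hc2 => ?_⟩ hP
      rcases Nat.lt_succ_iff_lt_or_eq.1 hc2 with h | h
      · exact hQ.2 c hc1 h
      · rw [h]; exact hi
    · rfl
  · by_cases h2 : OnePath.nS C r = n + 1
    · rw [if_pos ⟨h2.le, fun c hc1 hc2 => absurd hc1 (by omega)⟩, if_neg fun h => h1 h.1, if_pos h2]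
    · rw [if_neg fun h => absurd h.1 (by omega), if_neg fun h => h1 h.1, if_neg h2]

/-- A touched particle's gap restarts: only the slots starting right after the touch are pending. [folklore] -/
theorem gap_succ_of_touches {n : ℕ} {i : Fin (N + 1)} (hi : Touches C.σ N C.y n i) :
    gap C (n + 1) i = cnt C (n + 1) - cnt C n := by
  rw [← card_new n]
  unfold gap
  rw [Finset.card_filter, Finset.card_filter]
  refine Finset.sum_congr rfl fun r _ => ?_
  by_cases h2 : OnePath.nS C r = n + 1
  · rw [if_pos h2, if_pos ⟨h2.le, fun c hc1 hc2 => absurd hc1 (by omega)⟩]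
  · rw [if_neg h2, if_neg]
    rintro ⟨h3, h4⟩
    exact h4 n (by omega) (Nat.lt_succ_self n) hi

/-! ### §F First collisions of the current slot, idle slots of a gap -/

/-- The gap slots are the LAST `gap` started slots: every started `r ≥ cnt n − gap` is one. -/
private theorem gap_spec (hΔ : 0 < C.Δ) (hpos : 0 < OnePath.fin C) {n : ℕ} {i : Fin (N + 1)} {r : ℕ}
    (h1 : cnt C n - gap C n i ≤ r) (h2 : r < cnt C n) :
    OnePath.nS C r ≤ n ∧ ∀ c, OnePath.nS C r ≤ c → c < n → ¬ Touches C.σ N C.y c i := by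
  obtain ⟨hrS, hrn⟩ := (lt_cnt_iff hΔ hpos).1 h2
  refine ⟨hrn, ?_⟩
  by_contra hnot
  have hsub : ((Finset.range (S C)).filter fun r' =>
      OnePath.nS C r' ≤ n ∧ ∀ c, OnePath.nS C r' ≤ c → c < n → ¬ Touches C.σ N C.y c i) ⊆
      Finset.Ioo r (cnt C n) := by
    intro r' hr'
    rw [Finset.mem_filter, Finset.mem_range] at hr'
    rw [Finset.mem_Ioo]
    refine ⟨?_, (lt_cnt_iff hΔ hpos).2 ⟨hr'.1, hr'.2.1⟩⟩
    by_contra hle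
    have hS : 0 < 2 * C.m * C.L := lt_of_le_of_lt (Nat.zero_le _) hrS
    have hm := OnePath.slotStart_mono (σ := C.σ) (y := C.y) hΔ hpos hS (not_lt.1 hle) hrS.le
    exact hnot fun c hc1 hc2 => hr'.2.2 c (hm.trans hc1) hc2
  have := Finset.card_le_card hsub
  rw [Nat.card_Ioo] at this
  unfold gap at h1
  omega

/-- A touch with positive gap is the particle's FIRST collision of the current slot `cnt n − 1`. [folklore] -/
theorem cfirst_of_gap_pos (hΔ : 0 < C.Δ) (hpos : 0 < OnePath.fin C) (hm : 1 ≤ C.m) (hL : 1 ≤ C.L) {n : ℕ}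
    {i : Fin (N + 1)} (hn : n < OnePath.fin C) (ht : Touches C.σ N C.y n i) (hg : 1 ≤ gap C n i) :
    HasCollIn C.σ N C.y C.Δ (S C) (cnt C n - 1) i ∧ OnePath.cfirst C (cnt C n - 1) i = n := by
  have hS : 0 < 2 * C.m * C.L := Nat.mul_pos (Nat.mul_pos (by norm_num) hm) hL
  have hgc := gap_le_cnt (C := C) n i
  obtain ⟨hrn, hrt⟩ := gap_spec hΔ hpos (r := cnt C n - 1) (Nat.sub_le_sub_left hg _) (by omega)
  obtain ⟨hrS, -⟩ := (lt_cnt_iff hΔ hpos).1 (show cnt C n - 1 < cnt C n by omega)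
  have hnext : n < OnePath.nS C (cnt C n - 1 + 1) := by
    by_contra hle
    rcases Nat.lt_or_ge (cnt C n - 1 + 1) (S C) with h1 | h1
    · have := (lt_cnt_iff hΔ hpos).2 ⟨h1, not_lt.1 hle⟩
      omega
    · have h2 : cnt C n - 1 + 1 = 2 * C.m * C.L := by unfold S at h1 hrS; omega
      have hSS : OnePath.nS C (2 * C.m * C.L) = OnePath.fin C := OnePath.slotStart_self hS
      rw [h2, hSS] at hle
      exact hle hn
  have hH : HasCollIn C.σ N C.y C.Δ (S C) (cnt C n - 1) i := ⟨n, hrn, hnext, ht⟩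
  refine ⟨hH, ?_⟩
  obtain ⟨hc, hc1, _, hc3⟩ := OnePath.cfirst_spec (C := C) hH
  have hle : OnePath.cfirst C (cnt C n - 1) i ≤ n := by rw [hc]; exact Nat.find_min' hH ⟨hrn, hnext, ht⟩
  rcases hle.lt_or_eq with hlt | heq
  · exact absurd hc3 (hrt _ hc1 hlt)
  · exact heq

/-- The slots of a gap other than the current one are IDLE slots of the particle. [folklore] -/
theorem idleOn_of_gap (hΔ : 0 < C.Δ) (hpos : 0 < OnePath.fin C) (_hm : 1 ≤ C.m) (_hL : 1 ≤ C.L) {n : ℕ}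
    {i : Fin (N + 1)} {r : ℕ} (h1 : cnt C n - gap C n i ≤ r) (h2 : r + 1 < cnt C n) :
    IdleOn C.σ N C.y C.Δ (S C) r i := by
  obtain ⟨_, hr⟩ := gap_spec hΔ hpos h1 (by omega)
  have hr1 := ((lt_cnt_iff hΔ hpos).1 h2).2
  intro k hk1 hk2
  exact hr k hk1 (lt_of_lt_of_le hk2 hr1)

/-- At the end of the window every slot of the final gap is an idle slot of the particle. [folklore] -/
theorem idleOn_of_gap_fin (hΔ : 0 < C.Δ) (hpos : 0 < OnePath.fin C) (hm : 1 ≤ C.m) (hL : 1 ≤ C.L)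
    {i : Fin (N + 1)} {r : ℕ} (h1 : S C - gap C (OnePath.fin C) i ≤ r) (h2 : r < S C) :
    IdleOn C.σ N C.y C.Δ (S C) r i := by
  have hS : 0 < 2 * C.m * C.L := Nat.mul_pos (Nat.mul_pos (by norm_num) hm) hL
  have hcnt := cnt_fin hΔ hpos hm hL
  obtain ⟨_, hr⟩ := gap_spec hΔ hpos (n := OnePath.fin C) (i := i) (r := r) (by rw [hcnt]; exact h1)
    (by rw [hcnt]; exact h2)
  intro k hk1 hk2
  exact hr k hk1 (lt_of_lt_of_le hk2 (nS_le_fin hΔ hpos hS h2))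

/-- At a GOOD first collision the host hands over a fraction in `[η, 1 − η]`, unless it carries no tracer mass. [folklore] -/
theorem fr_mem_of_good {r n : ℕ} {i : Fin (N + 1)} (hg : i ∈ OnePath.Good C r) (hc : OnePath.cfirst C r i = n) :
    OnePath.mu C n i = 0 ∨ (C.η ≤ OnePath.fr C n i ∧ OnePath.fr C n i ≤ 1 - C.η) := by
  obtain ⟨h, hnd⟩ := hg
  unfold OnePath.cfirst at hc
  rw [dif_pos h] at hc
  rw [hc] at hnd
  unfold Degenerate at hnd
  rw [not_or, not_lt, not_lt] at hnd
  unfold OnePath.mu OnePath.fr shareFrac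
  set a := blockMass C.σ N C.y n i C.k
  by_cases h0 : a = 0
  · left
    rw [h0, zero_div]
  · right
    have ha : 0 < a := lt_of_le_of_ne (blockMass_nonneg _ _ _ _ _ _) (Ne.symm h0)
    exact ⟨(le_div_iff₀ ha).2 hnd.1, (div_le_iff₀ ha).2 hnd.2⟩

/-- The tracer law of an untouched particle does not move. [folklore] -/
theorem mu_eq_of_not_touches {n₁ n₂ : ℕ} (h12 : n₁ ≤ n₂) {i : Fin (N + 1)}
    (h : ∀ c, n₁ ≤ c → c < n₂ → ¬ Touches C.σ N C.y c i) : OnePath.mu C n₂ i = OnePath.mu C n₁ i := by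
  obtain ⟨d, rfl⟩ := Nat.exists_eq_add_of_le h12
  induction d with
  | zero => rfl
  | succ d ih =>
    rw [← add_assoc, OnePath.mu_succ_of_ne, ih (Nat.le_add_right _ _) fun c hc1 hc2 => h c hc1 (by omega)]
    intro h'
    have hnt := h (n₁ + d) (Nat.le_add_right _ _) (by omega)
    exact ⟨fun he => hnt ⟨h', Or.inl he.symm⟩, fun he => hnt ⟨h', Or.inr he.symm⟩⟩

/-- The endpoints of the reflected pair are exactly the touched particles. [folklore] -/
theorem touches_iff_of {n : ℕ} (h : (pairsAt C.σ N C.y n).Nonempty) (i : Fin (N + 1)) :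
    Touches C.σ N C.y n i ↔ (i = h.some.1 ∨ i = h.some.2) :=
  ⟨fun ⟨_, hor⟩ => hor.imp Eq.symm Eq.symm, fun hor => ⟨h, hor.imp Eq.symm Eq.symm⟩⟩

/-- No particle is touched by an idle step. [folklore] -/
theorem not_touches_of_not {n : ℕ} (h : ¬ (pairsAt C.σ N C.y n).Nonempty) (i : Fin (N + 1)) :
    ¬ Touches C.σ N C.y n i := fun ⟨h', _⟩ => h h'

end SlotLemmas

/-! ### §B The idle/degenerate charge budget, averaged over the sources with the row budget -/

section Budget

variable {σ : ℝ} {N : ℕ}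

/-- THE CHARGE BUDGET of slot `r`: summed over the sources `k`, the tracer mass (at the slot start) of the particles idle on the
slot plus the tracer mass (at their first collision of the slot) of the particles whose first collision is `η`-degenerate for the
block `(i, k)` is at most `(N+1)(idleFr_r + degFr_r)` (exact host uniformity `RowBudgetN`). [folklore] -/
theorem sum_charge_le (hRB : RowBudgetN σ) (y : Cfg N) (Δ η : ℝ) (m L r : ℕ) :
    ∑ k : Fin (N + 1), ∑ i : Fin (N + 1),
      ((if IdleOn σ N y Δ (2 * m * L) r i then
          OnePath.mu (⟨σ, y, Δ, η, m, L, k⟩ : OnePath.Src N) (slotStart σ N y Δ (2 * m * L) r) i else 0) +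
        (if HasCollIn σ N y Δ (2 * m * L) r i ∧ i ∉ OnePath.Good (⟨σ, y, Δ, η, m, L, k⟩ : OnePath.Src N) r then
          OnePath.mu (⟨σ, y, Δ, η, m, L, k⟩ : OnePath.Src N)
            (OnePath.cfirst (⟨σ, y, Δ, η, m, L, k⟩ : OnePath.Src N) r i) i else 0)) ≤
      ((N + 1 : ℕ) : ℝ) * (idleFr σ N y Δ (2 * m * L) r + degFr σ N y Δ (2 * m * L) r η) := by
  have hN : (0 : ℝ) < ((N + 1 : ℕ) : ℝ) := by positivity
  rw [Finset.sum_comm]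
  have hI : ∀ i : Fin (N + 1), (∑ k : Fin (N + 1), if IdleOn σ N y Δ (2 * m * L) r i then
      OnePath.mu (⟨σ, y, Δ, η, m, L, k⟩ : OnePath.Src N) (slotStart σ N y Δ (2 * m * L) r) i else 0) =
      if IdleOn σ N y Δ (2 * m * L) r i then (1 : ℝ) else 0 := by
    intro i
    split_ifs with h
    · simp only [OnePath.mu]
      rw [← Finset.sum_div, hRB N y _ i]
      norm_num
    · exact Finset.sum_const_zero
  have hD : ∀ i : Fin (N + 1), (∑ k : Fin (N + 1), if HasCollIn σ N y Δ (2 * m * L) r i ∧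
      i ∉ OnePath.Good (⟨σ, y, Δ, η, m, L, k⟩ : OnePath.Src N) r then
        OnePath.mu (⟨σ, y, Δ, η, m, L, k⟩ : OnePath.Src N)
          (OnePath.cfirst (⟨σ, y, Δ, η, m, L, k⟩ : OnePath.Src N) r i) i else 0) =
      degScore σ N y Δ (2 * m * L) r η i := by
    intro i
    unfold degScore
    by_cases h : HasCollIn σ N y Δ (2 * m * L) r i
    · rw [dif_pos h]
      refine Finset.sum_congr rfl fun k _ => ?_
      have hc : OnePath.cfirst (⟨σ, y, Δ, η, m, L, k⟩ : OnePath.Src N) r i = Nat.find h := by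
        unfold OnePath.cfirst
        exact dif_pos h
      rw [hc]
      by_cases hd : Degenerate η (blockMass σ N y (Nat.find h) i k)
          (blockShare σ N y (Nat.find h) i k (unitNormal σ N y (Nat.find h)))
      · rw [if_pos hd, mul_one, if_pos ⟨h, fun ⟨_, hq⟩ => hq hd⟩]
        rfl
      · rw [if_neg hd, mul_zero, if_neg fun ⟨_, hq⟩ => hq ⟨h, hd⟩]
    · rw [dif_neg h]
      exact Finset.sum_eq_zero fun k _ => if_neg fun h' => h h'.1
  refine le_of_eq ?_
  calc _ = ∑ i : Fin (N + 1), ((if IdleOn σ N y Δ (2 * m * L) r i then (1 : ℝ) else 0) +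
        degScore σ N y Δ (2 * m * L) r η i) :=
      Finset.sum_congr rfl fun i _ => by rw [Finset.sum_add_distrib, hI, hD]
    _ = _ := by
      rw [Finset.sum_add_distrib, Finset.sum_boole, OnePath.degFr_eq hRB, mul_add, ← mul_assoc,
        mul_inv_cancel₀ hN.ne', one_mul]
      unfold idleFr
      rw [mul_div_cancel₀ _ hN.ne']

end Budget

/-- REGISTERED HEADLINE (sub-goal `pairPath_cnt_fin`): by the last fold step every slot has started. [folklore] -/
theorem pairPath_cnt_fin : ∀ (N : ℕ) (C : OnePath.Src N), 0 < C.Δ → 0 < OnePath.fin C → 1 ≤ C.m → 1 ≤ C.L → PairPath.cnt C (OnePath.fin C) = PairPath.S C :=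
  fun _ _ hΔ hpos hm hL => cnt_fin hΔ hpos hm hL

end PairPath

end

end Summit.AtomisticToContinuum.HydrodynamicLimit.Theorems.DiffuseBackwardInfluenceShare
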